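import Mathlib
import Summits.Ventures.PercRepro2.LocRows
import Summits.Ventures.PercRepro2.SwRow
import Summits.Ventures.PercRepro2.SwOut
import Summits.Ventures.PercRepro2.SwAllRow
import Summits.Ventures.PercRepro2.SwOutAll
import Summits.Ventures.PercRepro2.SwOutArmFlip
import Summits.Ventures.PercRepro2.SwOutArms
import Summits.Ventures.PercRepro2.SwOutArmThm
import Summits.Ventures.PercRepro2.SwOutCoreDefs
import Summits.Ventures.PercRepro2.SwOutCoreHull
import Summits.Ventures.PercRepro2.SwOutCoreDual
import Summits.Ventures.PercRepro2.SwOutShadowDefs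
import Summits.Ventures.PercRepro2.SwOutShadowCube
import Summits.Ventures.PercRepro2.SwOutCoreShadowDefs
import Summits.Ventures.PercRepro2.SwOutCoreShadow
import Summits.Ventures.PercRepro2.SwOutJunction
import Summits.Ventures.PercRepro2.SwOutJunctionRegion
import Summits.Ventures.PercRepro2.SwOutCoreKey
import Summits.Ventures.PercRepro2.SwOutJunctionH1Defs
import Summits.Ventures.PercRepro2.SwOutJunctionH1Arms

/-!
# The hull and the coarse arms at a one-sided point and at its shadow points (blind cell
PercRepro2, night-4 g14, 2026-08-26; proofs/NIGHT4-G14.md §2)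

At a one-sided point `ω₀` of a core cube and at every point of its shadow cube the hull of `h` is
`{h} ∪ sX ∪ (far arms)` (`hull_coreReal_oneSided_eq`, `hull_shadowReal_eq`).  When the arms are
CONNECTED inside themselves (`ArmsConnected`; the concrete arms `armsC` are:
`armsConnected_armsC`), the coarse arms of `h` (`arm` / `arms` of the arm principle) at such a
point are exactly `sX` — the coarse arm of `u` — and the far arms (`arm_u_eq_sX`, `arm_far_eq`,
`exists_sB_of_mem_arms`): the coarse flip of `u` is `flip sX` (NIGHT4-G14.md §3).
-/

namespace Summit.Ventures.PercRepro2

namespace LocRows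

open Hull

variable {V : Type*} {E : Type*} [Fintype E] [DecidableEq E]

open scoped Classical

variable {ends : E → Sym2 V}

section Comp

variable {η : Config E} {h : V}

/-- The all-open colouring of the edges inside `P`. -/
noncomputable def withinConfig (ends : E → Sym2 V) (P : Set V) : Config E :=
  fun e => decide (e ∈ within ends P)

omit [Fintype E] [DecidableEq E] in
/-- An edge is open in `withinConfig P` iff it lies inside `P`. -/
lemma withinConfig_eq_true_iff {P : Set V} {e : E} :
    withinConfig ends P e = true ↔ e ∈ within ends P := by
  simp [withinConfig]

omit [Fintype E] [DecidableEq E] in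
/-- The inside colouring of a subset is below the inside colouring of the set. -/
lemma withinConfig_mono {P P' : Set V} (hP : P ⊆ P') : withinConfig ends P ≤ withinConfig ends P' := by
  intro e
  by_cases he : withinConfig ends P e = true
  · rw [he]
    obtain ⟨x, hx, y, hy, hxy⟩ := withinConfig_eq_true_iff.1 he
    rw [withinConfig_eq_true_iff.2 ⟨x, hP hx, y, hP hy, hxy⟩]
  · simp only [Bool.not_eq_true] at he
    rw [he]
    exact Bool.false_le _

omit [Fintype E] [DecidableEq E] in
/-- **A cluster is connected inside itself.** -/
theorem conn_withinConfig_of_mem_cluster {ω : Config E} {y x : V} (hx : x ∈ cluster ends ω y) :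
    Conn ends (withinConfig ends (cluster ends ω y)) y x := by
  -- the inside cluster lies in the cluster
  have hsub : ∀ v, v ∈ cluster ends (withinConfig ends (cluster ends ω y)) y → v ∈ cluster ends ω y := by
    intro v hv
    refine mem_of_conn_of_closed (ends := ends) (ω := withinConfig ends (cluster ends ω y))
      (S := cluster ends ω y) ?_ (mem_cluster_self _ _ _) hv
    intro a _ b hab
    obtain ⟨_, e, he, hends⟩ := openGraph_adj.1 hab
    obtain ⟨x', hx', y', hy', hxy'⟩ := withinConfig_eq_true_iff.1 he
    rw [hends, Sym2.eq_iff] at hxy'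
    rcases hxy' with ⟨_, h2⟩ | ⟨_, h2⟩
    · rw [h2]; exact hy'
    · rw [h2]; exact hx'
  refine mem_of_conn_of_closed (ends := ends) (ω := ω)
    (S := cluster ends (withinConfig ends (cluster ends ω y)) y) ?_ (mem_cluster_self _ _ _) hx
  intro a ha b hab
  obtain ⟨hne, e, he, hends⟩ := openGraph_adj.1 hab
  have haC : a ∈ cluster ends ω y := hsub a ha
  have hbC : b ∈ cluster ends ω y := mem_cluster_of_edge haC he hends
  exact mem_cluster_of_adj ha (adj_of_edge hne (withinConfig_eq_true_iff.2 ⟨a, haC, b, hbC, hends⟩)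
    hends)

/-- `P` is a component of `G[hull ∖ {h}]`: arm-closed and connected inside itself. -/
structure IsComp (ends : E → Sym2 V) (η : Config E) (h : V) (P : Set V) : Prop where
  closed : ArmClosed ends η h P
  conn : ∀ x ∈ P, ∀ y ∈ P, Conn ends (withinConfig ends P) x y

omit [Fintype E] [DecidableEq E] in
/-- The coarse arm of a vertex of a component is the component. -/
theorem arm_eq_of_isComp {P : Set V} (hP : IsComp ends η h P) {x : V} (hx : x ∈ P) :
    arm ends η h x = P := by
  apply Set.Subset.antisymm
  · intro v hv
    refine mem_of_conn_of_closed (ends := ends) (ω := armConfig ends η h) (S := P) ?_ hx hv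
    intro a ha b hab
    obtain ⟨_, e, he, hends⟩ := openGraph_adj.1 hab
    obtain ⟨x', hx', y', hy', hxy'⟩ := armConfig_eq_true_iff.1 he
    have hbH : b ∈ hull ends η h ∧ b ≠ h := by
      rw [hends, Sym2.eq_iff] at hxy'
      rcases hxy' with ⟨_, h2⟩ | ⟨_, h2⟩
      · rw [h2]; simpa using hy'
      · rw [h2]; simpa using hx'
    exact hP.closed.closed e a b hends ha hbH.1 hbH.2
  · intro v hv
    have hc := hP.conn x hx v hv
    refine conn_mono ?_ hc
    intro e
    by_cases he : withinConfig ends P e = true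
    · rw [he]
      obtain ⟨x', hx', y', hy', hxy'⟩ := withinConfig_eq_true_iff.1 he
      have h1 := hP.closed.subset x' hx'
      have h2 := hP.closed.subset y' hy'
      rw [armConfig_eq_true_iff.2 ⟨x', ⟨h1.1, by simpa using h1.2⟩, y', ⟨h2.1, by simpa using h2.2⟩,
        hxy'⟩]
    · simp only [Bool.not_eq_true] at he
      rw [he]
      exact Bool.false_le _

omit [DecidableEq E] in
/-- A nonempty component is a coarse arm. -/
theorem mem_arms_of_isComp {P : Set V} (hP : IsComp ends η h P) (hne : P.Nonempty) :
    P ∈ arms ends η h := by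
  obtain ⟨x, hx⟩ := hne
  obtain ⟨hxH, hxh⟩ := hP.closed.subset x hx
  obtain ⟨Q, hQ, hxQ⟩ := exists_mem_arms hxH hxh
  have hQx : Q = arm ends η h x := by
    simp only [arms, Finset.mem_image] at hQ
    obtain ⟨e, he, rfl⟩ := hQ
    obtain ⟨y, _, _, _, hPy⟩ := armOfEdge_eq_arm he
    rw [hPy] at hxQ ⊢
    exact (arm_eq_of_mem hxQ).symm
  rw [← arm_eq_of_isComp hP hx, ← hQx]
  exact hQ

omit [DecidableEq E] in
/-- When components `C j` cover `hull ∖ {h}`, every coarse arm is one of them. -/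
theorem exists_eq_of_mem_arms {κ : Type*} {C : κ → Set V} (hC : ∀ j, IsComp ends η h (C j))
    (hcover : ∀ x ∈ hull ends η h, x ≠ h → ∃ j, x ∈ C j) {P : Set V} (hP : P ∈ arms ends η h) :
    ∃ j, P = C j := by
  simp only [arms, Finset.mem_image] at hP
  obtain ⟨e, he, rfl⟩ := hP
  obtain ⟨y, _, hyh, hyH, hPy⟩ := armOfEdge_eq_arm he
  obtain ⟨j, hyj⟩ := hcover y hyH hyh
  exact ⟨j, by rw [hPy, arm_eq_of_isComp (hC j) hyj]⟩

end Comp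

section OneSided

variable {ι : Type*} {A : ι → Set V} {pure : ι → Prop} {ζ : Config E} {h u : V} {H : Set V}
  (hb : CoreBase ends ζ h u H A pure) {ω₀ : Config ι}
  (huR : uRed ends A u pure ω₀) (huB : ¬ uRed ends A u pure (flipAll ω₀))
include hb huR huB

omit [Fintype E] [DecidableEq E] in
/-- **The hull at a one-sided point**: `h`, the coarse arm of `u` and the far arms. -/
theorem CoreBase.hull_coreReal_oneSided_eq :
    hull ends (coreReal ends A ζ ω₀) h = {h} ∪ {x | ∃ j, x ∈ sB ends u A ω₀ j} := by
  ext x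
  simp only [hull, Set.mem_union, Set.mem_singleton_iff, Set.mem_setOf_eq]
  rw [hb.cluster_coreReal, hb.cluster_blue_coreReal, mem_redSet_iff, mem_redSet_iff]
  constructor
  · rintro ((rfl | ⟨i, hi, hpi, hx⟩ | ⟨_, rfl | ⟨i, hi, hpi, hx⟩⟩) |
      (rfl | ⟨i, hi, hpi, hx⟩ | ⟨hu', _⟩))
    · exact Or.inl rfl
    · by_cases hadj : uAdjC ends u A i
      · exact Or.inr ⟨none, by simp only [sB]; exact mem_sX_iff.2 (Or.inr ⟨i, hadj, hi, hx⟩)⟩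
      · exact Or.inr ⟨some ⟨i, hadj⟩, hx⟩
    · exact Or.inr ⟨none, by simp only [sB]; exact mem_sX_iff.2 (Or.inl rfl)⟩
    · refine Or.inr ⟨none, ?_⟩
      simp only [sB]
      exact mem_sX_iff.2 (Or.inr ⟨i, hb.uAdjC_of_pure hpi, hi, hx⟩)
    · exact Or.inl rfl
    · by_cases hadj : uAdjC ends u A i
      · exfalso
        obtain ⟨e, y, huy, hy⟩ := hadj
        exact huB ⟨i, hi, hpi, e, y, huy, hy⟩
      · exact Or.inr ⟨some ⟨i, hadj⟩, hx⟩
    · exact absurd hu' huB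
  · rintro (rfl | ⟨j, hj⟩)
    · exact Or.inl (Or.inl rfl)
    · rcases j with _ | ⟨i, hadj⟩
      · simp only [sB] at hj
        rcases mem_sX_iff.1 hj with rfl | ⟨i, _, hi, hx⟩
        · exact Or.inl (Or.inr (Or.inr ⟨huR, Or.inl rfl⟩))
        · by_cases hpi : pure i
          · exact Or.inl (Or.inr (Or.inr ⟨huR, Or.inr ⟨i, hi, hpi, hx⟩⟩))
          · exact Or.inl (Or.inr (Or.inl ⟨i, hi, hpi, hx⟩))
      · have hpi : ¬ pure i := hb.not_pure_of_not_uAdjC hadj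
        cases hi : ω₀ i with
        | true => exact Or.inl (Or.inr (Or.inl ⟨i, hi, hpi, hj⟩))
        | false =>
          right; right; left
          exact ⟨i, by simp only [flipAll, hi]; rfl, hpi, hj⟩

omit [Fintype E] [DecidableEq E] in
/-- **The hull at a shadow point**: `h`, the coarse arm of `u` and the far arms. -/
theorem CoreBase.hull_shadowReal_eq (ω' : Config (Option {i : ι // ¬ uAdjC ends u A i})) :
    hull ends (shadowReal ends (sB ends u A ω₀) (sZ ends u A ω₀) none
      (shadowOf ends u A ω₀ ζ) ω') h = {h} ∪ {x | ∃ j, x ∈ sB ends u A ω₀ j} := by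
  have hs := hb.shadowBase huR huB
  ext x
  simp only [hull, Set.mem_union, Set.mem_singleton_iff, Set.mem_setOf_eq]
  rw [hs.cluster_shadowReal, hs.cluster_blue_shadowReal, mem_sRed_iff, mem_sRed_iff]
  constructor
  · rintro ((rfl | ⟨j, _, hx⟩) | (rfl | ⟨j, _, hx⟩))
    · exact Or.inl rfl
    · exact Or.inr ⟨j, hx⟩
    · exact Or.inl rfl
    · exact Or.inr ⟨j, hx⟩
  · rintro (rfl | ⟨j, hj⟩)
    · exact Or.inl (Or.inl rfl)
    · cases hω : ω' j with
      | true => exact Or.inl (Or.inr ⟨j, hω, hj⟩)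
      | false => exact Or.inr (Or.inr ⟨j, by simp only [flipAll, hω]; rfl, hj⟩)

omit [Fintype E] [DecidableEq E] huR huB in
/-- A vertex of an arm lies in `{h} ∪ sX ∪ far` iff the arm is not dropped. -/
lemma CoreBase.mem_region_iff_of_mem_arm {i : ι} {x : V} (hx : x ∈ A i) :
    x ∈ {h} ∪ {x | ∃ j, x ∈ sB ends u A ω₀ j} ↔ (uAdjC ends u A i → ω₀ i = true) := by
  simp only [Set.mem_union, Set.mem_singleton_iff, Set.mem_setOf_eq]
  constructor
  · rintro (rfl | ⟨j, hj⟩) hadj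
    · exact absurd hx (hb.h_notMem_arm i)
    · rcases j with _ | ⟨i', hi'⟩
      · simp only [sB] at hj
        rcases mem_sX_iff.1 hj with rfl | ⟨i', hadj', hi', hx'⟩
        · exact absurd hx (hb.u_notMem_arm i)
        · have : i' = i := by
            by_contra hne
            exact hb.arm_disj i' i hne x hx' hx
          subst this; exact hi'
      · have : i' = i := by
          by_contra hne
          exact hb.arm_disj i' i hne x hj hx
        subst this; exact absurd hadj hi'
  · intro hi
    by_cases hadj : uAdjC ends u A i
    · exact Or.inr ⟨none, by simp only [sB]; exact mem_sX_iff.2 (Or.inr ⟨i, hadj, hi hadj, hx⟩)⟩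
    · exact Or.inr ⟨some ⟨i, hadj⟩, hx⟩

end OneSided

section Coarse

variable {ι : Type*} (A : ι → Set V)

/-- The arms are connected inside themselves. -/
def ArmsConnected (ends : E → Sym2 V) : Prop :=
  ∀ i, ∀ x ∈ A i, ∀ y ∈ A i, Conn ends (withinConfig ends (A i)) x y

variable {A} {pure : ι → Prop} {ζ : Config E} {h u : V} {H : Set V}
  (hb : CoreBase ends ζ h u H A pure) {ω₀ : Config ι} (hconn : ArmsConnected A ends)
  {η : Config E} (hH : hull ends η h = {h} ∪ {x | ∃ j, x ∈ sB ends u A ω₀ j})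
include hb hconn hH

omit [Fintype E] [DecidableEq E] hconn in
/-- A vertex of `sX` or of a far arm lies in `hull ∖ {h}`. -/
lemma CoreBase.mem_hull_sdiff_of_mem_sB {j : Option {i : ι // ¬ uAdjC ends u A i}} {x : V}
    (hx : x ∈ sB ends u A ω₀ j) : x ∈ hull ends η h ∧ x ≠ h := by
  refine ⟨by rw [hH]; exact Or.inr ⟨j, hx⟩, ?_⟩
  rintro rfl
  rcases j with _ | ⟨i, _⟩
  · simp only [sB] at hx
    rcases mem_sX_iff.1 hx with hh | ⟨i, _, _, hh⟩
    · exact hb.hne hh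
    · exact hb.h_notMem_arm i hh
  · exact hb.h_notMem_arm i hx

omit [Fintype E] [DecidableEq E] hconn in
/-- No edge joins `sX` to a far arm. -/
lemma CoreBase.no_edge_sX_far {e : E} {x y : V} (hxy : ends e = s(x, y)) (hx : x ∈ sX ends u A ω₀)
    {i : ι} (hi : ¬ uAdjC ends u A i) (hy : y ∈ A i) : False := by
  have hxu : x = u := hb.eq_u_of_edge_sX hxy hx hy (fun h' => hi h'.1)
  subst hxu
  exact hi ⟨e, y, hxy, hy⟩

omit [Fintype E] [DecidableEq E] in
/-- `sX` is a component of `G[hull ∖ {h}]`. -/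
theorem CoreBase.isComp_sX : IsComp ends η h (sX ends u A ω₀) where
  closed := by
    refine ⟨fun x hx => hb.mem_hull_sdiff_of_mem_sB hH (j := none) hx, ?_⟩
    intro e x y hxy hx hyH hyh
    rw [hH] at hyH
    rcases hyH with hyh' | ⟨j, hyj⟩
    · exact absurd hyh' hyh
    · rcases j with _ | ⟨i, hi⟩
      · exact hyj
      · exact absurd hyj (fun hyj => hb.no_edge_sX_far hH hxy hx hi hyj)
  conn := by
    -- every vertex of `sX` is joined to `u` inside `sX`
    have key : ∀ x ∈ sX ends u A ω₀, Conn ends (withinConfig ends (sX ends u A ω₀)) u x := by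
      intro x hx
      rcases mem_sX_iff.1 hx with rfl | ⟨i, hadj, hi, hxi⟩
      · exact conn_refl _ _ _
      · obtain ⟨e, x₀, hux₀, hx₀⟩ := hadj
        have hx₀X : x₀ ∈ sX ends u A ω₀ := mem_sX_iff.2 (Or.inr ⟨i, ⟨e, x₀, hux₀, hx₀⟩, hi, hx₀⟩)
        have h1 : Conn ends (withinConfig ends (sX ends u A ω₀)) u x₀ :=
          conn_of_openAdj ⟨e, withinConfig_eq_true_iff.2
            ⟨u, mem_sX_iff.2 (Or.inl rfl), x₀, hx₀X, hux₀⟩, hux₀⟩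
        have h2 : Conn ends (withinConfig ends (sX ends u A ω₀)) x₀ x := by
          refine conn_mono (withinConfig_mono ?_) (hconn i x₀ hx₀ x hxi)
          intro v hv
          exact mem_sX_iff.2 (Or.inr ⟨i, ⟨e, x₀, hux₀, hx₀⟩, hi, hv⟩)
        exact conn_trans h1 h2
    intro x hx y hy
    exact conn_trans (conn_symm (key x hx)) (key y hy)

omit [Fintype E] [DecidableEq E] in
/-- A far arm is a component of `G[hull ∖ {h}]`. -/
theorem CoreBase.isComp_far {i : ι} (hi : ¬ uAdjC ends u A i) : IsComp ends η h (A i) where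
  closed := by
    refine ⟨fun x hx => hb.mem_hull_sdiff_of_mem_sB hH (j := some ⟨i, hi⟩) hx, ?_⟩
    intro e x y hxy hx hyH hyh
    rw [hH] at hyH
    rcases hyH with hyh' | ⟨j, hyj⟩
    · exact absurd hyh' hyh
    · rcases j with _ | ⟨i', hi'⟩
      · exact absurd hyj (fun hyj => hb.no_edge_sX_far hH (ends_swap hxy) hyj hi hx)
      · have : i = i' := hb.arm_eq_of_edge hxy hx hyj
        subst this; exact hyj
  conn := fun x hx y hy => hconn i x hx y hy

omit [Fintype E] [DecidableEq E] in
/-- **The coarse arm of `u` is `sX`.** -/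
theorem CoreBase.arm_u_eq_sX : arm ends η h u = sX ends u A ω₀ :=
  arm_eq_of_isComp (hb.isComp_sX hconn hH) (mem_sX_iff.2 (Or.inl rfl))

omit [Fintype E] [DecidableEq E] in
/-- **The coarse arm of a far vertex is its far arm.** -/
theorem CoreBase.arm_far_eq {i : ι} (hi : ¬ uAdjC ends u A i) {x : V} (hx : x ∈ A i) :
    arm ends η h x = A i :=
  arm_eq_of_isComp (hb.isComp_far hconn hH hi) hx

omit [DecidableEq E] in
/-- **The coarse arms are `sX` and the far arms.** -/
theorem CoreBase.exists_sB_of_mem_arms {P : Set V} (hP : P ∈ arms ends η h) :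
    ∃ j, P = sB ends u A ω₀ j := by
  refine exists_eq_of_mem_arms (C := sB ends u A ω₀) ?_ ?_ hP
  · rintro (_ | ⟨i, hi⟩)
    · exact hb.isComp_sX hconn hH
    · exact hb.isComp_far hconn hH hi
  · intro x hxH hxh
    rw [hH] at hxH
    rcases hxH with rfl | ⟨j, hj⟩
    · exact absurd rfl hxh
    · exact ⟨j, hj⟩

omit [DecidableEq E] in
/-- `sX` is a coarse arm. -/
theorem CoreBase.sX_mem_arms : sX ends u A ω₀ ∈ arms ends η h :=
  mem_arms_of_isComp (hb.isComp_sX hconn hH) ⟨u, mem_sX_iff.2 (Or.inl rfl)⟩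

omit [DecidableEq E] in
/-- A far arm is a coarse arm. -/
theorem CoreBase.far_mem_arms {i : ι} (hi : ¬ uAdjC ends u A i) : A i ∈ arms ends η h :=
  mem_arms_of_isComp (hb.isComp_far hconn hH hi) (hb.arm_nonempty i)

end Coarse

section Concrete

variable {U : Set V} {h u : V}

omit [DecidableEq E] in
/-- **The concrete arms `armsC` are connected inside themselves.** -/
theorem armsConnected_armsC (η : Config E) :
    ArmsConnected (fun P : armsC ends h u η => P.1) ends := by
  intro P x hx y hy
  obtain ⟨y₀, _, _, _, hP⟩ := exists_of_mem_armsC P.2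
  simp only at hx hy ⊢
  rw [hP] at hx hy ⊢
  have h1 := conn_withinConfig_of_mem_cluster (ω := armConfigC ends h u η) hx
  have h2 := conn_withinConfig_of_mem_cluster (ω := armConfigC ends h u η) hy
  exact conn_trans (conn_symm h1) h2

end Concrete

end LocRows

end Summit.Ventures.PercRepro2
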